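import Literature.Probability.LatticeModels.LipschitzRiemannSum
import HarnessLib

/-!
# Riemann sums of periodic functions over the momentum grid: the SECOND-ORDER rate from second differences

Topic `Probability/LatticeModels`; companion of `LipschitzRiemannSum.lean` (first-order rate `O(K/L)` for
`K`-Lipschitz periodic integrands, `abs_sum_torusSite_two_sub_integral_le`) and of
`BrillouinRiemannSumRate.lean` (`O(K/L)` in every dimension). For SMOOTH periodic integrands the
left-endpoint sum over a full period is the composite MIDPOINT rule (shift the window by half a step;
the integral over a period does not depend on the window), whose error is second order: on a centred
cell `[c − h/2, c + h/2]`, `∫ g − h g(c) = ∫₀^{h/2} (g(c+t) − 2g(c) + g(c−t)) dt`, so a bound on the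
symmetric SECOND DIFFERENCE `|g(x+t) − 2g(x) + g(x−t)| ≤ M t²` (e.g. `M = sup|g″|`) gives `|·| ≤ M h³/8`
per cell and `M T h²/8` over a period (Davis–Rabinowitz §2.1 (2.1.6) with the midpoint node; Faul §5,
composite midpoint rule). The hypothesis is DERIVATIVE-FREE, so the two-dimensional product rule
follows exactly as in the first-order file: the section integral `F(y) = ∫ f(x,y) dx` inherits the
second-difference bound `2π M_y t²` from `f` without differentiating under the integral sign.

PROVED here (no definitions, no named facts):
* `abs_mul_sub_integral_cell_le_of_secondDiff` — `|h g(c) − ∫_{c−h/2}^{c+h/2} g| ≤ M (h/2)² (h/2) = M h³/8`;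
* `abs_riemannSum_sub_integral_le_of_secondDiff` — `g` `T`-periodic, continuous, second differences
  `≤ M t²`: `|h Σ_{j<L} g(jh) − ∫_a^{a+T} g| ≤ M T h²/8`, `h = T/L`;
* `abs_riemannSum_two_sub_integral_le_of_secondDiff` — `f` jointly continuous, `2π`-periodic and with
  second differences `≤ M_x t²` / `≤ M_y t²` in each variable separately, `h = 2π/L`:
  `|h² Σ_{j,k<L} f(jh, kh) − ∫_{−π}^{π}∫_{−π}^{π} f| ≤ π²(M_x + M_y) h²/2`;
* `abs_sum_torusSite_two_sub_integral_le_of_secondDiff` — the torus packaging: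
  `|Σ_{k ∈ (ℤ/L)²} f(p_k) − L²/(4π²) ∫∫ f| ≤ π²(M_x + M_y)/2`, i.e.
  **`|L⁻² Σ_k f(p_k) − (4π²)⁻¹ ∫∫ f| ≤ π²(M_x + M_y)/(2L²)`** for every `L ≥ 1`.

USE (cell hubbard-cq / hubbard-obs, W4 sourced cap `∃ L₀ ∀ L ≥ L₀`): for Brillouin-zone integrands of
BCS type at inverse temperature `β` the first derivatives are `O(β)` but the `O(1/L)` rate then needs
`L ~ β/ε`; with second differences `O(β²)` the `O(1/L²)` rate needs only `L ~ β/√ε`.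

PRIOR ART IN THE TREE (what this file adds). `Analysis/Quadrature/MidpointTrapezoidPeanoKernel.lean` has the
compound midpoint rule error `ζ(b−a)³/(24n²)` under `C²` hypotheses (`HasDerivAt` twice, fixed window, one
dimension; sharper constant `1/24`); `Analysis/Quadrature/TrapezoidalRulePeriodic.lean` the EXPONENTIAL rate
for periodic functions analytic in a strip (Trefethen–Weideman Thm 4.2, one dimension) and
`LatticeRulesAnalytic.lean` its rank-1-lattice-rule several-variable form; `LipschitzRiemannSum.lean` the
first-order torus-grid form. New here: the DERIVATIVE-FREE second-difference hypothesis (so that section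
integrals inherit it by integrating the hypothesis), the periodic window shift, and the two-dimensional
PRODUCT-grid packaging on the momentum torus `(ℤ/L)²` with an explicit constant (cruder `1/8` per cell).

## References
* P. J. Davis, P. Rabinowitz, *Methods of Numerical Integration*, 2nd ed. (1984), §2.1 eq. (2.1.6) and
  the periodic remark `T_n = R_n = R̄_n` (p. 52). [DavisRabinowitz1984]
* A. C. Faul, *A Concise Introduction to Numerical Analysis* (2016), §5 (composite midpoint rule and
  its second-order error; product rules). [Faul2016]
* S. Friedli, Y. Velenik, *Statistical Mechanics of Lattice Systems* (2017), §10.5.2 (momentum sums of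
  the torus as Riemann sums). [FriedliVelenikSMLS2017]
-/

noncomputable section

namespace Literature.Probability.LatticeModels

open MeasureTheory Finset Real

/-! ### One dimension -/

/-- One centred cell of the midpoint rule under a second-difference bound: if `g` is continuous and
`|g(x+t) − 2g(x) + g(x−t)| ≤ M t²` for all `x` and `t ≥ 0`, then
`|h g(c) − ∫_{c−h/2}^{c+h/2} g| ≤ M (h/2)² (h/2)` (fold the cell about its midpoint:
`∫_{c−h/2}^{c+h/2} g = ∫₀^{h/2} (g(c+t) + g(c−t)) dt`). [cite: Faul2016, §5 (composite midpoint rule)] -/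
theorem abs_mul_sub_integral_cell_le_of_secondDiff {g : ℝ → ℝ} {M : ℝ} (hg : Continuous g)
    (h2 : ∀ x t, 0 ≤ t → |g (x + t) - 2 * g x + g (x - t)| ≤ M * t ^ 2) (c : ℝ) {h : ℝ}
    (hh : 0 ≤ h) :
    |h * g c - ∫ x in (c - h / 2)..(c + h / 2), g x| ≤ M * (h / 2) ^ 2 * (h / 2) := by
  -- fold the cell
  have hsplit : ∫ x in (c - h / 2)..(c + h / 2), g x =
      (∫ x in (c - h / 2)..c, g x) + ∫ x in c..(c + h / 2), g x :=
    (intervalIntegral.integral_add_adjacent_intervals (hg.intervalIntegrable _ _)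
      (hg.intervalIntegrable _ _)).symm
  have hleft : ∫ x in (c - h / 2)..c, g x = ∫ t in (0 : ℝ)..(h / 2), g (c - t) := by
    rw [intervalIntegral.integral_comp_sub_left (fun x => g x) c, sub_zero]
  have hright : ∫ x in c..(c + h / 2), g x = ∫ t in (0 : ℝ)..(h / 2), g (c + t) := by
    rw [intervalIntegral.integral_comp_add_left (fun x => g x) c, add_zero]
  have hconst : h * g c = ∫ _ in (0 : ℝ)..(h / 2), 2 * g c := by
    rw [intervalIntegral.integral_const, smul_eq_mul]; ring
  have hi1 : IntervalIntegrable (fun t => g (c - t)) volume 0 (h / 2) :=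
    (hg.comp (continuous_const.sub continuous_id)).intervalIntegrable _ _
  have hi2 : IntervalIntegrable (fun t => g (c + t)) volume 0 (h / 2) :=
    (hg.comp (continuous_const.add continuous_id)).intervalIntegrable _ _
  rw [hsplit, hleft, hright, hconst, ← intervalIntegral.integral_add hi1 hi2,
    ← intervalIntegral.integral_sub intervalIntegrable_const (hi1.add hi2)]
  have hbound : ∀ t ∈ Set.uIoc (0 : ℝ) (h / 2),
      ‖2 * g c - (g (c - t) + g (c + t))‖ ≤ M * (h / 2) ^ 2 := by
    intro t ht
    rw [Set.uIoc_of_le (by linarith)] at ht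
    have ht0 : 0 ≤ t := ht.1.le
    have hM : 0 ≤ M := by
      -- `0 ≤ |…| ≤ M · 1²`
      have h1 := h2 c 1 zero_le_one
      rw [one_pow, mul_one] at h1
      exact (abs_nonneg _).trans h1
    rw [Real.norm_eq_abs, show 2 * g c - (g (c - t) + g (c + t)) =
      -(g (c + t) - 2 * g c + g (c - t)) by ring, abs_neg]
    exact (h2 c t ht0).trans (mul_le_mul_of_nonneg_left (pow_le_pow_left₀ ht0 ht.2 2) hM)
  have := intervalIntegral.norm_integral_le_of_norm_le_const hbound
  rw [Real.norm_eq_abs, sub_zero, abs_of_nonneg (by linarith : 0 ≤ h / 2)] at this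
  linarith [this]

/-- **Midpoint (= periodic rectangle) rule over one period, second order.** For `g` continuous,
`T`-periodic, with `|g(x+t) − 2g(x) + g(x−t)| ≤ M t²` (`t ≥ 0`), `0 < L`, `h = T/L`, and any window
`b = a + T`: `|h Σ_{j<L} g(jh) − ∫_a^b g| ≤ M T h²/8` (the window is shifted to the centred cells
`[jh − h/2, jh + h/2]`, on each of which `abs_mul_sub_integral_cell_le_of_secondDiff` applies).
[cite: DavisRabinowitz1984, §2.1 eq. (2.1.6)] [cite: Faul2016, §5 (composite midpoint rule)] -/
theorem abs_riemannSum_sub_integral_le_of_secondDiff {g : ℝ → ℝ} {M T : ℝ} (hg : Continuous g)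
    (hT : 0 < T) (hper : Function.Periodic g T)
    (h2 : ∀ x t, 0 ≤ t → |g (x + t) - 2 * g x + g (x - t)| ≤ M * t ^ 2)
    {L : ℕ} (hL : 0 < L) {a b : ℝ} (hab : b = a + T) :
    |T / L * ∑ j ∈ Finset.range L, g (j * (T / L)) - ∫ x in a..b, g x| ≤
      M * T * (T / L) ^ 2 / 8 := by
  subst hab
  set h := T / L with hh_def
  have hL' : (0 : ℝ) < L := Nat.cast_pos.2 hL
  have hh : 0 < h := div_pos hT hL'
  have hLh : (L : ℝ) * h = T := by rw [hh_def]; field_simp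
  rw [hper.intervalIntegral_add_eq a (-(h / 2))]
  have hadj := intervalIntegral.sum_integral_adjacent_intervals (f := g) (μ := volume)
    (a := fun j : ℕ => -(h / 2) + (j : ℝ) * h) (n := L) fun k _ => hg.intervalIntegrable _ _
  simp only [Nat.cast_zero, zero_mul, add_zero] at hadj
  rw [hLh] at hadj
  rw [← hadj, Finset.mul_sum, ← Finset.sum_sub_distrib]
  calc |∑ j ∈ Finset.range L, (h * g (j * h) -
          ∫ x in (-(h / 2) + (j : ℝ) * h)..(-(h / 2) + ((j + 1 : ℕ) : ℝ) * h), g x)|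
      ≤ ∑ j ∈ Finset.range L, |h * g (j * h) -
          ∫ x in (-(h / 2) + (j : ℝ) * h)..(-(h / 2) + ((j + 1 : ℕ) : ℝ) * h), g x| :=
        Finset.abs_sum_le_sum_abs _ _
    _ ≤ ∑ _j ∈ Finset.range L, M * (h / 2) ^ 2 * (h / 2) := Finset.sum_le_sum fun j _ => by
        rw [show -(h / 2) + (j : ℝ) * h = j * h - h / 2 by ring,
          show -(h / 2) + ((j + 1 : ℕ) : ℝ) * h = j * h + h / 2 by push_cast; ring]
        exact abs_mul_sub_integral_cell_le_of_secondDiff hg h2 _ hh.le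
    _ = M * T * h ^ 2 / 8 := by
        rw [Finset.sum_const, Finset.card_range, nsmul_eq_mul, ← hLh]; ring

/-! ### Two dimensions: the Brillouin torus `[-π, π]²` -/

/-- **Two-dimensional product midpoint rule over the Brillouin torus, second order.** For `f` jointly
continuous, `2π`-periodic in each variable, with second differences `≤ M_x t²` in `x` and `≤ M_y t²` in
`y` (each uniformly in the other variable), `0 < L`, `h = 2π/L`:
`|h² Σ_{k<L} Σ_{j<L} f(jh, kh) − ∫_{−π}^{π}∫_{−π}^{π} f| ≤ π²(M_x + M_y) h²/2` — the one-dimensional bound in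
`x` at every grid `y`, plus the one-dimensional bound for the section integral `y ↦ ∫ f(x,y) dx`, whose
second differences are `≤ 2π M_y t²` (no differentiation under the integral sign is needed).
[cite: Faul2016, §5 (composite midpoint rule)] [cite: DavisRabinowitz1984, §2.1 eq. (2.1.6)] -/
theorem abs_riemannSum_two_sub_integral_le_of_secondDiff {f : ℝ → ℝ → ℝ} {Mx My : ℝ}
    (hf : Continuous fun p : ℝ × ℝ => f p.1 p.2)
    (hperx : ∀ y, Function.Periodic (fun x => f x y) (2 * π))
    (hpery : ∀ x, Function.Periodic (f x) (2 * π))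
    (h2x : ∀ x t y, 0 ≤ t → |f (x + t) y - 2 * f x y + f (x - t) y| ≤ Mx * t ^ 2)
    (h2y : ∀ x y t, 0 ≤ t → |f x (y + t) - 2 * f x y + f x (y - t)| ≤ My * t ^ 2)
    {L : ℕ} (hL : 0 < L) :
    |(2 * π / L) ^ 2 * ∑ k ∈ Finset.range L, ∑ j ∈ Finset.range L,
        f (j * (2 * π / L)) (k * (2 * π / L)) - ∫ y in (-π)..π, ∫ x in (-π)..π, f x y| ≤
      π ^ 2 * (Mx + My) * (2 * π / L) ^ 2 / 2 := by
  set h := 2 * π / L with hh_def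
  have hπ := Real.pi_pos
  have hT : (0 : ℝ) < 2 * π := by positivity
  have hL' : (0 : ℝ) < L := Nat.cast_pos.2 hL
  have hh : 0 < h := div_pos hT hL'
  have hLeq : (L : ℝ) = 2 * π / h := by rw [hh_def]; field_simp
  -- sections are continuous
  have hcx : ∀ y, Continuous fun x => f x y := fun y =>
    hf.comp (Continuous.prodMk continuous_id continuous_const)
  have hcy : ∀ x, Continuous fun y => f x y := fun x =>
    hf.comp (Continuous.prodMk continuous_const continuous_id)
  set F : ℝ → ℝ := fun y => ∫ x in (-π)..π, f x y with hF_def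
  have hFper : Function.Periodic F (2 * π) := fun y => by
    simp only [hF_def]
    exact intervalIntegral.integral_congr fun x _ => hpery x y
  have hFcont : Continuous F := by
    have hunc : Continuous (Function.uncurry fun (y x : ℝ) => f x y) :=
      hf.comp (Continuous.prodMk continuous_snd continuous_fst)
    exact intervalIntegral.continuous_parametric_intervalIntegral_of_continuous' hunc (-π) π
  have hF2 : ∀ y t, 0 ≤ t → |F (y + t) - 2 * F y + F (y - t)| ≤ 2 * π * My * t ^ 2 := by
    intro y t ht
    simp only [hF_def]
    have hi1 := (hcx (y + t)).intervalIntegrable (μ := volume) (-π) π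
    have hi2 := (hcx y).intervalIntegrable (μ := volume) (-π) π
    have hi3 := (hcx (y - t)).intervalIntegrable (μ := volume) (-π) π
    rw [show (2 : ℝ) * ∫ x in (-π)..π, f x y = ∫ x in (-π)..π, 2 * f x y by
        rw [intervalIntegral.integral_const_mul],
      ← intervalIntegral.integral_sub hi1 (hi2.const_mul 2),
      ← intervalIntegral.integral_add (hi1.sub (hi2.const_mul 2)) hi3]
    have hb : ∀ x ∈ Set.uIoc (-π) π, ‖f x (y + t) - 2 * f x y + f x (y - t)‖ ≤ My * t ^ 2 :=
      fun x _ => by rw [Real.norm_eq_abs]; exact h2y x y t ht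
    have := intervalIntegral.norm_integral_le_of_norm_le_const hb
    rw [Real.norm_eq_abs, show π - -π = 2 * π by ring, abs_of_pos hT] at this
    linarith
  set S : ℕ → ℝ := fun k => ∑ j ∈ Finset.range L, f (j * h) (k * h) with hS_def
  have h1 : ∀ k ∈ Finset.range L, |h * S k - F (k * h)| ≤ Mx * (2 * π) * h ^ 2 / 8 := fun k _ =>
    abs_riemannSum_sub_integral_le_of_secondDiff (hcx (k * h)) hT (hperx (k * h))
      (fun x t ht => h2x x t (k * h) ht) hL (by ring)
  have h2 : |h * ∑ k ∈ Finset.range L, F (k * h) - ∫ y in (-π)..π, F y| ≤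
      2 * π * My * (2 * π) * h ^ 2 / 8 :=
    abs_riemannSum_sub_integral_le_of_secondDiff hFcont hT hFper hF2 hL (by ring)
  have hsplit : h ^ 2 * ∑ k ∈ Finset.range L, S k - ∫ y in (-π)..π, F y =
      h * ∑ k ∈ Finset.range L, (h * S k - F (k * h)) +
        (h * ∑ k ∈ Finset.range L, F (k * h) - ∫ y in (-π)..π, F y) := by
    rw [Finset.sum_sub_distrib, ← Finset.mul_sum]; ring
  rw [hsplit]
  calc |h * ∑ k ∈ Finset.range L, (h * S k - F (k * h)) +
          (h * ∑ k ∈ Finset.range L, F (k * h) - ∫ y in (-π)..π, F y)|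
      ≤ |h * ∑ k ∈ Finset.range L, (h * S k - F (k * h))| +
          |h * ∑ k ∈ Finset.range L, F (k * h) - ∫ y in (-π)..π, F y| := abs_add_le _ _
    _ ≤ h * ∑ _k ∈ Finset.range L, Mx * (2 * π) * h ^ 2 / 8 +
          2 * π * My * (2 * π) * h ^ 2 / 8 := by
        refine add_le_add ?_ h2
        rw [abs_mul, abs_of_pos hh]
        exact mul_le_mul_of_nonneg_left
          ((Finset.abs_sum_le_sum_abs _ _).trans (Finset.sum_le_sum h1)) hh.le
    _ = π ^ 2 * (Mx + My) * h ^ 2 / 2 := by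
        rw [Finset.sum_const, Finset.card_range, nsmul_eq_mul, hLeq]
        field_simp
        ring

/-! ### The momentum grid of the discrete torus `(ℤ/L)²` -/

/-- **Momentum sums against zone integrals, second-order rate.** For `f` jointly continuous,
`2π`-periodic, with second differences `≤ M_x t²`, `≤ M_y t²` in each variable, and every `L ≥ 1`:
`|Σ_{k ∈ (ℤ/L)²} f(p_k) − L²/(4π²) ∫_{−π}^{π}∫_{−π}^{π} f| ≤ π²(M_x + M_y)/2`, i.e.
`|L⁻² Σ_k f(p_k) − (4π²)⁻¹ ∫∫ f| ≤ π²(M_x + M_y)/(2L²)` — the second-order companion of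
`abs_sum_torusSite_two_sub_integral_le`. [cite: FriedliVelenikSMLS2017, §10.5.2 (reciprocal torus)]
[cite: Faul2016, §5 (composite midpoint rule)] -/
theorem abs_sum_torusSite_two_sub_integral_le_of_secondDiff {f : ℝ → ℝ → ℝ} {Mx My : ℝ}
    (hf : Continuous fun p : ℝ × ℝ => f p.1 p.2)
    (hperx : ∀ y, Function.Periodic (fun x => f x y) (2 * π))
    (hpery : ∀ x, Function.Periodic (f x) (2 * π))
    (h2x : ∀ x t y, 0 ≤ t → |f (x + t) y - 2 * f x y + f (x - t) y| ≤ Mx * t ^ 2)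
    (h2y : ∀ x y t, 0 ≤ t → |f x (y + t) - 2 * f x y + f x (y - t)| ≤ My * t ^ 2)
    (L : ℕ) [NeZero L] :
    |∑ k : TorusSite 2 L, f (latticeMomentum L k 0) (latticeMomentum L k 1) -
        (L : ℝ) ^ 2 / (4 * π ^ 2) * ∫ y in (-π)..π, ∫ x in (-π)..π, f x y| ≤
      π ^ 2 * (Mx + My) / 2 := by
  have hL : 0 < L := Nat.pos_of_ne_zero (NeZero.ne L)
  have hL' : (0 : ℝ) < L := Nat.cast_pos.2 hL
  have hπ := Real.pi_pos
  have h2 := abs_riemannSum_two_sub_integral_le_of_secondDiff hf hperx hpery h2x h2y hL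
  rw [← sum_torusSite_two_eq_sum_range f L] at h2
  set S := ∑ k : TorusSite 2 L, f (latticeMomentum L k 0) (latticeMomentum L k 1)
  set I := ∫ y in (-π)..π, ∫ x in (-π)..π, f x y
  have hc : (0 : ℝ) < (L : ℝ) ^ 2 / (4 * π ^ 2) := by positivity
  have key : S - (L : ℝ) ^ 2 / (4 * π ^ 2) * I =
      (L : ℝ) ^ 2 / (4 * π ^ 2) * ((2 * π / L) ^ 2 * S - I) := by
    field_simp
    ring
  have key2 : (L : ℝ) ^ 2 / (4 * π ^ 2) * (π ^ 2 * (Mx + My) * (2 * π / L) ^ 2 / 2) =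
      π ^ 2 * (Mx + My) / 2 := by
    field_simp
    ring
  rw [key, abs_mul, abs_of_pos hc, ← key2]
  exact mul_le_mul_of_nonneg_left h2 hc.le

/-- The same in the normalised form `|L⁻² Σ_k f(p_k) − (4π²)⁻¹ ∫∫ f| ≤ π²(M_x + M_y)/(2L²)`.
[cite: FriedliVelenikSMLS2017, §10.5.2 (reciprocal torus)] [cite: Faul2016, §5 (composite midpoint rule)] -/
theorem abs_avg_torusSite_two_sub_integral_le_of_secondDiff {f : ℝ → ℝ → ℝ} {Mx My : ℝ}
    (hf : Continuous fun p : ℝ × ℝ => f p.1 p.2)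
    (hperx : ∀ y, Function.Periodic (fun x => f x y) (2 * π))
    (hpery : ∀ x, Function.Periodic (f x) (2 * π))
    (h2x : ∀ x t y, 0 ≤ t → |f (x + t) y - 2 * f x y + f (x - t) y| ≤ Mx * t ^ 2)
    (h2y : ∀ x y t, 0 ≤ t → |f x (y + t) - 2 * f x y + f x (y - t)| ≤ My * t ^ 2)
    (L : ℕ) [NeZero L] :
    |(∑ k : TorusSite 2 L, f (latticeMomentum L k 0) (latticeMomentum L k 1)) / (L : ℝ) ^ 2 -
        (∫ y in (-π)..π, ∫ x in (-π)..π, f x y) / (4 * π ^ 2)| ≤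
      π ^ 2 * (Mx + My) / (2 * (L : ℝ) ^ 2) := by
  have hL' : (0 : ℝ) < L := Nat.cast_pos.2 (Nat.pos_of_ne_zero (NeZero.ne L))
  have hL2 : (0 : ℝ) < (L : ℝ) ^ 2 := by positivity
  have hπ := Real.pi_pos
  have h := abs_sum_torusSite_two_sub_integral_le_of_secondDiff hf hperx hpery h2x h2y L
  have hdiv := div_le_div_of_nonneg_right h hL2.le
  rw [← abs_of_pos hL2, ← abs_div, abs_of_pos hL2] at hdiv
  have hrw : (∑ k : TorusSite 2 L, f (latticeMomentum L k 0) (latticeMomentum L k 1) -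
        (L : ℝ) ^ 2 / (4 * π ^ 2) * ∫ y in (-π)..π, ∫ x in (-π)..π, f x y) / (L : ℝ) ^ 2 =
      (∑ k : TorusSite 2 L, f (latticeMomentum L k 0) (latticeMomentum L k 1)) / (L : ℝ) ^ 2 -
        (∫ y in (-π)..π, ∫ x in (-π)..π, f x y) / (4 * π ^ 2) := by
    field_simp
  rw [hrw] at hdiv
  calc _ ≤ π ^ 2 * (Mx + My) / 2 / (L : ℝ) ^ 2 := hdiv
    _ = π ^ 2 * (Mx + My) / (2 * (L : ℝ) ^ 2) := by rw [div_div]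

end Literature.Probability.LatticeModels
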